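import Summits.CriticalPhenomena.PercolationContinuityZ3.Theorems.PercNearOneGluingNoHeavyLowerTailSunflowerChainEndpointShifted

/-!
# The root-ordered endpoint lemma (six slots): exact vertex reduction for power certificates with ALL faces priced

(prove-1 gen 57; memo run/shared/lean/prim/prim-ineq-prove-1/FINDING-VERTEX-prove1-g57.md §1.)
Along a fibre `t ∈ [t₀, t₁]` of the petal polytope the value `G = A + B·t` is affine and every budget usage is affine,
`u_i = (b_i t + a_i)/f_i` (`b_i ≥ 0`).  If every slot satisfies the ROOT CONDITION `a_i·B ≤ A·b_i` (the root of `G` lies to the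
left of the root of `u_i`; slots with `b_i = 0` are constant and exempt), then in the variable `v = log G` the left side is `e^v` and
every `log u_i` is concave (`u_i = d_i G − c_i` with `c_i ≥ 0`), so `A + B t ≤ C ∏ u_i^{l_i}` (`l_i ≥ 0`) holds on `[t₀, t₁]` as soon as
it holds at the two endpoints.  Proof: geometric interpolation `G(t) = G(t₀)^a G(t₁)^b` and the shifted geometric-mean inequality
`shifted_gm_le` slot by slot (`slot_base_gm_le`, `slot_gm_le`), then the product (`affine_le_prod6_rpow_of_endpoints`, six slots —
the shape of the six-budget certificate `g·(y/α₀₀)^λ_y (k/α₀₁)^λ_k (g/α₀₁)^λ_g (h/α₁₁)^λ_h (Ȳ/b_Ȳ)^λ_Ȳ (H/b_H)^λ_H`). [this work]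
-/

namespace Summit.CriticalPhenomena.PercolationContinuityZ3.Theorems.SunflowerPartition.SafeCalc.LinkedCurrency

/-- One slot, base form: if `G₀^a G₁^b = G(t)` (geometric interpolation of the affine `G = A + Bt`, `B > 0`) and the slot
`b·t + a` is constant (`b = 0`) or satisfies the root condition `a·B ≤ A·b`, then `(b t₀ + a)^a (b t₁ + a)^b ≤ b t + a`. [this work] -/
theorem slot_base_gm_le {A B t₀ t₁ t wa wb a b : ℝ} (hB : 0 < B) (ht₀ : t₀ ≤ t) (ht₁ : t ≤ t₁)
    (hwa : 0 ≤ wa) (hwb : 0 ≤ wb) (hw : wa + wb = 1) (hG₀ : 0 < A + B * t₀)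
    (hG : (A + B * t₀) ^ wa * (A + B * t₁) ^ wb = A + B * t)
    (hb : 0 ≤ b) (hp : 0 < b * t₀ + a) (hr : b = 0 ∨ a * B ≤ A * b) :
    (b * t₀ + a) ^ wa * (b * t₁ + a) ^ wb ≤ b * t + a := by
  rcases hr with hb0 | hr
  · rw [hb0, zero_mul, zero_add, zero_mul, zero_add, zero_mul, zero_add]
    rw [hb0, zero_mul, zero_add] at hp
    rw [← Real.rpow_add hp, hw, Real.rpow_one]
  · have hBne : B ≠ 0 := ne_of_gt hB
    have hG₁ : 0 < A + B * t₁ := lt_of_lt_of_le hG₀ (by nlinarith [ht₀.trans ht₁])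
    obtain ⟨d, hd⟩ : ∃ d : ℝ, d = b / B := ⟨_, rfl⟩
    obtain ⟨c, hc⟩ : ∃ c : ℝ, c = b * A / B - a := ⟨_, rfl⟩
    have hd0 : 0 ≤ d := by rw [hd]; exact div_nonneg hb hB.le
    have hc0 : 0 ≤ c := by
      rw [hc, sub_nonneg, le_div_iff₀ hB]; linarith
    have id : ∀ x : ℝ, b * x + a = d * (A + B * x) - c := by
      intro x; rw [hd, hc]; field_simp; ring
    have hU : c < d * (A + B * t₀) := by have h := hp; rw [id t₀] at h; linarith
    have hV : c < d * (A + B * t₁) := by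
      have h : 0 < b * t₁ + a := by nlinarith [mul_le_mul_of_nonneg_left (ht₀.trans ht₁) hb]
      rw [id t₁] at h; linarith
    have key := shifted_gm_le hc0 hU hV hwa hwb hw
    have hdw : d ^ wa * d ^ wb = d := by rw [← Real.rpow_add' hd0 (by rw [hw]; norm_num), hw, Real.rpow_one]
    have e : (d * (A + B * t₀)) ^ wa * (d * (A + B * t₁)) ^ wb = d * (A + B * t) := by
      rw [Real.mul_rpow hd0 hG₀.le, Real.mul_rpow hd0 hG₁.le]
      calc d ^ wa * (A + B * t₀) ^ wa * (d ^ wb * (A + B * t₁) ^ wb)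
          = (d ^ wa * d ^ wb) * ((A + B * t₀) ^ wa * (A + B * t₁) ^ wb) := by ring
        _ = d * (A + B * t) := by rw [hdw, hG]
    rw [e, ← id t₀, ← id t₁, ← id t] at key
    exact key

/-- One slot of the root-ordered endpoint lemma, with the scaling `/f` and the exponent `l ≥ 0`. [this work] -/
theorem slot_gm_le {A B t₀ t₁ t wa wb a b f l : ℝ} (hB : 0 < B) (ht₀ : t₀ ≤ t) (ht₁ : t ≤ t₁)
    (hwa : 0 ≤ wa) (hwb : 0 ≤ wb) (hw : wa + wb = 1) (hG₀ : 0 < A + B * t₀)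
    (hG : (A + B * t₀) ^ wa * (A + B * t₁) ^ wb = A + B * t)
    (hb : 0 ≤ b) (hf : 0 < f) (hl : 0 ≤ l) (hp : 0 < b * t₀ + a) (hr : b = 0 ∨ a * B ≤ A * b) :
    (((b * t₀ + a) / f) ^ l) ^ wa * (((b * t₁ + a) / f) ^ l) ^ wb ≤ ((b * t + a) / f) ^ l := by
  have hp₁ : 0 < b * t₁ + a := by nlinarith [mul_le_mul_of_nonneg_left (ht₀.trans ht₁) hb]
  have hu0 : 0 ≤ (b * t₀ + a) / f := div_nonneg hp.le hf.le
  have hu1 : 0 ≤ (b * t₁ + a) / f := div_nonneg hp₁.le hf.le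
  rw [← Real.rpow_mul hu0, ← Real.rpow_mul hu1, mul_comm l wa, mul_comm l wb, Real.rpow_mul hu0, Real.rpow_mul hu1,
    ← Real.mul_rpow (Real.rpow_nonneg hu0 _) (Real.rpow_nonneg hu1 _)]
  apply Real.rpow_le_rpow (mul_nonneg (Real.rpow_nonneg hu0 _) (Real.rpow_nonneg hu1 _)) _ hl
  rw [Real.div_rpow hp.le hf.le, Real.div_rpow hp₁.le hf.le, div_mul_div_comm]
  have hfw : f ^ wa * f ^ wb = f := by rw [← Real.rpow_add hf, hw, Real.rpow_one]
  rw [hfw]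
  exact div_le_div_of_nonneg_right (slot_base_gm_le hB ht₀ ht₁ hwa hwb hw hG₀ hG hb hp hr) hf.le

/-- Monotonicity of a six-fold product with a nonnegative constant in front. [this work] -/
theorem mul6_le_mul6 {C x₁ x₂ x₃ x₄ x₅ x₆ y₁ y₂ y₃ y₄ y₅ y₆ : ℝ} (hC : 0 ≤ C)
    (h₁ : 0 ≤ x₁) (h₂ : 0 ≤ x₂) (h₃ : 0 ≤ x₃) (h₄ : 0 ≤ x₄) (h₅ : 0 ≤ x₅) (h₆ : 0 ≤ x₆)
    (e₁ : x₁ ≤ y₁) (e₂ : x₂ ≤ y₂) (e₃ : x₃ ≤ y₃) (e₄ : x₄ ≤ y₄) (e₅ : x₅ ≤ y₅) (e₆ : x₆ ≤ y₆) :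
    C * x₁ * x₂ * x₃ * x₄ * x₅ * x₆ ≤ C * y₁ * y₂ * y₃ * y₄ * y₅ * y₆ := by
  have g₁ : 0 ≤ y₁ := h₁.trans e₁
  have g₂ : 0 ≤ y₂ := h₂.trans e₂
  have g₃ : 0 ≤ y₃ := h₃.trans e₃
  have g₄ : 0 ≤ y₄ := h₄.trans e₄
  have g₅ : 0 ≤ y₅ := h₅.trans e₅
  have s1 : C * x₁ ≤ C * y₁ := mul_le_mul_of_nonneg_left e₁ hC
  have s2 : C * x₁ * x₂ ≤ C * y₁ * y₂ := mul_le_mul s1 e₂ h₂ (mul_nonneg hC g₁)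
  have s3 : C * x₁ * x₂ * x₃ ≤ C * y₁ * y₂ * y₃ := mul_le_mul s2 e₃ h₃ (mul_nonneg (mul_nonneg hC g₁) g₂)
  have s4 : C * x₁ * x₂ * x₃ * x₄ ≤ C * y₁ * y₂ * y₃ * y₄ :=
    mul_le_mul s3 e₄ h₄ (mul_nonneg (mul_nonneg (mul_nonneg hC g₁) g₂) g₃)
  have s5 : C * x₁ * x₂ * x₃ * x₄ * x₅ ≤ C * y₁ * y₂ * y₃ * y₄ * y₅ :=
    mul_le_mul s4 e₅ h₅ (mul_nonneg (mul_nonneg (mul_nonneg (mul_nonneg hC g₁) g₂) g₃) g₄)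
  exact mul_le_mul s5 e₆ h₆ (mul_nonneg (mul_nonneg (mul_nonneg (mul_nonneg (mul_nonneg hC g₁) g₂) g₃) g₄) g₅)

/-- `(C x₁ ⋯ x₆)^w = C^w x₁^w ⋯ x₆^w` for nonnegative reals. [this work] -/
theorem rpow_mul7 {C x₁ x₂ x₃ x₄ x₅ x₆ w : ℝ} (hC : 0 ≤ C)
    (h₁ : 0 ≤ x₁) (h₂ : 0 ≤ x₂) (h₃ : 0 ≤ x₃) (h₄ : 0 ≤ x₄) (h₅ : 0 ≤ x₅) (h₆ : 0 ≤ x₆) :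
    (C * x₁ * x₂ * x₃ * x₄ * x₅ * x₆) ^ w = C ^ w * x₁ ^ w * x₂ ^ w * x₃ ^ w * x₄ ^ w * x₅ ^ w * x₆ ^ w := by
  have n1 : 0 ≤ C * x₁ := mul_nonneg hC h₁
  have n2 : 0 ≤ C * x₁ * x₂ := mul_nonneg n1 h₂
  have n3 : 0 ≤ C * x₁ * x₂ * x₃ := mul_nonneg n2 h₃
  have n4 : 0 ≤ C * x₁ * x₂ * x₃ * x₄ := mul_nonneg n3 h₄
  have n5 : 0 ≤ C * x₁ * x₂ * x₃ * x₄ * x₅ := mul_nonneg n4 h₅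
  rw [Real.mul_rpow n5 h₆, Real.mul_rpow n4 h₅, Real.mul_rpow n3 h₄, Real.mul_rpow n2 h₃, Real.mul_rpow n1 h₂,
    Real.mul_rpow hC h₁]

/-- Geometric-interpolation weights: for `0 < G₀ < G₁` and `G₀ ≤ G ≤ G₁` there are `a, b ≥ 0`, `a + b = 1` with
`G₀^a G₁^b = G`. [this work] -/
theorem exists_gm_weights {G₀ G₁ G : ℝ} (h0 : 0 < G₀) (h01 : G₀ < G₁) (hl : G₀ ≤ G) (hu : G ≤ G₁) :
    ∃ a b : ℝ, 0 ≤ a ∧ 0 ≤ b ∧ a + b = 1 ∧ G₀ ^ a * G₁ ^ b = G := by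
  have hG : 0 < G := lt_of_lt_of_le h0 hl
  have h1 : 0 < G₁ := lt_trans h0 h01
  have hden : 0 < Real.log G₁ - Real.log G₀ := sub_pos.2 (Real.log_lt_log h0 h01)
  refine ⟨(Real.log G₁ - Real.log G) / (Real.log G₁ - Real.log G₀),
    (Real.log G - Real.log G₀) / (Real.log G₁ - Real.log G₀), ?_, ?_, ?_, ?_⟩
  · exact div_nonneg (sub_nonneg.2 (Real.log_le_log hG hu)) hden.le
  · exact div_nonneg (sub_nonneg.2 (Real.log_le_log h0 hl)) hden.le
  · rw [← add_div]; field_simp; ring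
  · have hlog : (Real.log G₁ - Real.log G) / (Real.log G₁ - Real.log G₀) * Real.log G₀ +
        (Real.log G - Real.log G₀) / (Real.log G₁ - Real.log G₀) * Real.log G₁ = Real.log G := by
      field_simp; ring
    rw [Real.rpow_def_of_pos h0, Real.rpow_def_of_pos h1, ← Real.exp_add, mul_comm (Real.log G₀), mul_comm (Real.log G₁), hlog,
      Real.exp_log hG]

/-- Nonnegativity of a slot factor `((b t + a)/f)^l` on the fibre. [this work] -/
theorem slot_nonneg {b a f l t₀ t : ℝ} (hb : 0 ≤ b) (hf : 0 < f) (hp : 0 < b * t₀ + a) (ht : t₀ ≤ t) :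
    0 ≤ ((b * t + a) / f) ^ l :=
  Real.rpow_nonneg (div_nonneg (by nlinarith [mul_le_mul_of_nonneg_left ht hb]) hf.le) _


/-- **Root-ordered endpoint lemma, six slots.**  `A, C ≥ 0`, `B > 0`, `0 < t₀ ≤ t ≤ t₁`; slots `(b_i t + a_i)/f_i` with `b_i ≥ 0`,
`f_i > 0`, exponents `l_i ≥ 0`, positive at `t₀`, and each either constant (`b_i = 0`) or root-ordered (`a_i B ≤ A b_i`).  Then
`A + Bt ≤ C ∏_i ((b_i t + a_i)/f_i)^{l_i}` at `t₀` and at `t₁` implies the same at `t`. [this work] -/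
theorem affine_le_prod6_rpow_of_endpoints
    {A B C t₀ t₁ t a₁ b₁ f₁ l₁ a₂ b₂ f₂ l₂ a₃ b₃ f₃ l₃ a₄ b₄ f₄ l₄ a₅ b₅ f₅ l₅ a₆ b₆ f₆ l₆ : ℝ}
    (hA : 0 ≤ A) (hB : 0 < B) (hC : 0 ≤ C) (ht₀ : 0 < t₀) (h₀ : t₀ ≤ t) (h₁ : t ≤ t₁)
    (hb₁ : 0 ≤ b₁) (hf₁ : 0 < f₁) (hl₁ : 0 ≤ l₁) (hp₁ : 0 < b₁ * t₀ + a₁) (hr₁ : b₁ = 0 ∨ a₁ * B ≤ A * b₁)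
    (hb₂ : 0 ≤ b₂) (hf₂ : 0 < f₂) (hl₂ : 0 ≤ l₂) (hp₂ : 0 < b₂ * t₀ + a₂) (hr₂ : b₂ = 0 ∨ a₂ * B ≤ A * b₂)
    (hb₃ : 0 ≤ b₃) (hf₃ : 0 < f₃) (hl₃ : 0 ≤ l₃) (hp₃ : 0 < b₃ * t₀ + a₃) (hr₃ : b₃ = 0 ∨ a₃ * B ≤ A * b₃)
    (hb₄ : 0 ≤ b₄) (hf₄ : 0 < f₄) (hl₄ : 0 ≤ l₄) (hp₄ : 0 < b₄ * t₀ + a₄) (hr₄ : b₄ = 0 ∨ a₄ * B ≤ A * b₄)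
    (hb₅ : 0 ≤ b₅) (hf₅ : 0 < f₅) (hl₅ : 0 ≤ l₅) (hp₅ : 0 < b₅ * t₀ + a₅) (hr₅ : b₅ = 0 ∨ a₅ * B ≤ A * b₅)
    (hb₆ : 0 ≤ b₆) (hf₆ : 0 < f₆) (hl₆ : 0 ≤ l₆) (hp₆ : 0 < b₆ * t₀ + a₆) (hr₆ : b₆ = 0 ∨ a₆ * B ≤ A * b₆)
    (e₀ : A + B * t₀ ≤ C * ((b₁ * t₀ + a₁) / f₁) ^ l₁ * ((b₂ * t₀ + a₂) / f₂) ^ l₂ * ((b₃ * t₀ + a₃) / f₃) ^ l₃ *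
      ((b₄ * t₀ + a₄) / f₄) ^ l₄ * ((b₅ * t₀ + a₅) / f₅) ^ l₅ * ((b₆ * t₀ + a₆) / f₆) ^ l₆)
    (e₁ : A + B * t₁ ≤ C * ((b₁ * t₁ + a₁) / f₁) ^ l₁ * ((b₂ * t₁ + a₂) / f₂) ^ l₂ * ((b₃ * t₁ + a₃) / f₃) ^ l₃ *
      ((b₄ * t₁ + a₄) / f₄) ^ l₄ * ((b₅ * t₁ + a₅) / f₅) ^ l₅ * ((b₆ * t₁ + a₆) / f₆) ^ l₆) :
    A + B * t ≤ C * ((b₁ * t + a₁) / f₁) ^ l₁ * ((b₂ * t + a₂) / f₂) ^ l₂ * ((b₃ * t + a₃) / f₃) ^ l₃ *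
      ((b₄ * t + a₄) / f₄) ^ l₄ * ((b₅ * t + a₅) / f₅) ^ l₅ * ((b₆ * t + a₆) / f₆) ^ l₆ := by
  rcases eq_or_lt_of_le (h₀.trans h₁) with heq | hlt
  · have : t = t₀ := le_antisymm (heq ▸ h₁) h₀
    rw [this]; exact e₀
  have hG0 : 0 < A + B * t₀ := add_pos_of_nonneg_of_pos hA (mul_pos hB ht₀)
  have ht : 0 < t := lt_of_lt_of_le ht₀ h₀
  have hG1 : 0 < A + B * t₁ := add_pos_of_nonneg_of_pos hA (mul_pos hB (lt_of_lt_of_le ht h₁))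
  have hG01 : A + B * t₀ < A + B * t₁ := by nlinarith
  obtain ⟨wa, wb, hwa, hwb, hw, hG⟩ :=
    exists_gm_weights hG0 hG01 (by nlinarith : A + B * t₀ ≤ A + B * t) (by nlinarith : A + B * t ≤ A + B * t₁)
  -- the six slots
  have s₁ := slot_gm_le hB h₀ h₁ hwa hwb hw hG0 hG hb₁ hf₁ hl₁ hp₁ hr₁
  have s₂ := slot_gm_le hB h₀ h₁ hwa hwb hw hG0 hG hb₂ hf₂ hl₂ hp₂ hr₂
  have s₃ := slot_gm_le hB h₀ h₁ hwa hwb hw hG0 hG hb₃ hf₃ hl₃ hp₃ hr₃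
  have s₄ := slot_gm_le hB h₀ h₁ hwa hwb hw hG0 hG hb₄ hf₄ hl₄ hp₄ hr₄
  have s₅ := slot_gm_le hB h₀ h₁ hwa hwb hw hG0 hG hb₅ hf₅ hl₅ hp₅ hr₅
  have s₆ := slot_gm_le hB h₀ h₁ hwa hwb hw hG0 hG hb₆ hf₆ hl₆ hp₆ hr₆
  -- nonnegativity of the slot factors at the endpoints
  have h01 : t₀ ≤ t₁ := h₀.trans h₁
  have n1 : 0 ≤ ((b₁ * t₀ + a₁) / f₁) ^ l₁ := slot_nonneg hb₁ hf₁ hp₁ (le_refl t₀)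
  have n2 : 0 ≤ ((b₂ * t₀ + a₂) / f₂) ^ l₂ := slot_nonneg hb₂ hf₂ hp₂ (le_refl t₀)
  have n3 : 0 ≤ ((b₃ * t₀ + a₃) / f₃) ^ l₃ := slot_nonneg hb₃ hf₃ hp₃ (le_refl t₀)
  have n4 : 0 ≤ ((b₄ * t₀ + a₄) / f₄) ^ l₄ := slot_nonneg hb₄ hf₄ hp₄ (le_refl t₀)
  have n5 : 0 ≤ ((b₅ * t₀ + a₅) / f₅) ^ l₅ := slot_nonneg hb₅ hf₅ hp₅ (le_refl t₀)
  have n6 : 0 ≤ ((b₆ * t₀ + a₆) / f₆) ^ l₆ := slot_nonneg hb₆ hf₆ hp₆ (le_refl t₀)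
  have m1 : 0 ≤ ((b₁ * t₁ + a₁) / f₁) ^ l₁ := slot_nonneg hb₁ hf₁ hp₁ h01
  have m2 : 0 ≤ ((b₂ * t₁ + a₂) / f₂) ^ l₂ := slot_nonneg hb₂ hf₂ hp₂ h01
  have m3 : 0 ≤ ((b₃ * t₁ + a₃) / f₃) ^ l₃ := slot_nonneg hb₃ hf₃ hp₃ h01
  have m4 : 0 ≤ ((b₄ * t₁ + a₄) / f₄) ^ l₄ := slot_nonneg hb₄ hf₄ hp₄ h01
  have m5 : 0 ≤ ((b₅ * t₁ + a₅) / f₅) ^ l₅ := slot_nonneg hb₅ hf₅ hp₅ h01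
  have m6 : 0 ≤ ((b₆ * t₁ + a₆) / f₆) ^ l₆ := slot_nonneg hb₆ hf₆ hp₆ h01
  have hR0 : 0 ≤ C * ((b₁ * t₀ + a₁) / f₁) ^ l₁ * ((b₂ * t₀ + a₂) / f₂) ^ l₂ * ((b₃ * t₀ + a₃) / f₃) ^ l₃ *
      ((b₄ * t₀ + a₄) / f₄) ^ l₄ * ((b₅ * t₀ + a₅) / f₅) ^ l₅ * ((b₆ * t₀ + a₆) / f₆) ^ l₆ :=
    mul_nonneg (mul_nonneg (mul_nonneg (mul_nonneg (mul_nonneg (mul_nonneg hC n1) n2) n3) n4) n5) n6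
  -- generic names for the fourteen factors
  set X1 := ((b₁ * t₀ + a₁) / f₁) ^ l₁ with hX1
  set X2 := ((b₂ * t₀ + a₂) / f₂) ^ l₂ with hX2
  set X3 := ((b₃ * t₀ + a₃) / f₃) ^ l₃ with hX3
  set X4 := ((b₄ * t₀ + a₄) / f₄) ^ l₄ with hX4
  set X5 := ((b₅ * t₀ + a₅) / f₅) ^ l₅ with hX5
  set X6 := ((b₆ * t₀ + a₆) / f₆) ^ l₆ with hX6
  set Y1 := ((b₁ * t₁ + a₁) / f₁) ^ l₁ with hY1
  set Y2 := ((b₂ * t₁ + a₂) / f₂) ^ l₂ with hY2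
  set Y3 := ((b₃ * t₁ + a₃) / f₃) ^ l₃ with hY3
  set Y4 := ((b₄ * t₁ + a₄) / f₄) ^ l₄ with hY4
  set Y5 := ((b₅ * t₁ + a₅) / f₅) ^ l₅ with hY5
  set Y6 := ((b₆ * t₁ + a₆) / f₆) ^ l₆ with hY6
  -- Step 1/2: G(t) = G₀^wa G₁^wb ≤ RHS₀^wa RHS₁^wb
  have step2 : A + B * t ≤ (C * X1 * X2 * X3 * X4 * X5 * X6) ^ wa * (C * Y1 * Y2 * Y3 * Y4 * Y5 * Y6) ^ wb := by
    rw [← hG]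
    exact mul_le_mul (Real.rpow_le_rpow hG0.le e₀ hwa) (Real.rpow_le_rpow hG1.le e₁ hwb) (Real.rpow_nonneg hG1.le _)
      (Real.rpow_nonneg hR0 _)
  -- Step 3: expand and interpolate slot by slot
  have hCw : C ^ wa * C ^ wb = C := by rw [← Real.rpow_add' hC (by rw [hw]; norm_num), hw, Real.rpow_one]
  rw [rpow_mul7 hC n1 n2 n3 n4 n5 n6, rpow_mul7 hC m1 m2 m3 m4 m5 m6] at step2
  have step3 : C ^ wa * X1 ^ wa * X2 ^ wa * X3 ^ wa * X4 ^ wa * X5 ^ wa * X6 ^ wa *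
      (C ^ wb * Y1 ^ wb * Y2 ^ wb * Y3 ^ wb * Y4 ^ wb * Y5 ^ wb * Y6 ^ wb)
      = (C ^ wa * C ^ wb) * (X1 ^ wa * Y1 ^ wb) * (X2 ^ wa * Y2 ^ wb) * (X3 ^ wa * Y3 ^ wb) * (X4 ^ wa * Y4 ^ wb) *
          (X5 ^ wa * Y5 ^ wb) * (X6 ^ wa * Y6 ^ wb) := by ring
  rw [step3, hCw] at step2
  refine step2.trans ?_
  exact mul6_le_mul6 hC (mul_nonneg (Real.rpow_nonneg n1 _) (Real.rpow_nonneg m1 _))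
    (mul_nonneg (Real.rpow_nonneg n2 _) (Real.rpow_nonneg m2 _)) (mul_nonneg (Real.rpow_nonneg n3 _) (Real.rpow_nonneg m3 _))
    (mul_nonneg (Real.rpow_nonneg n4 _) (Real.rpow_nonneg m4 _)) (mul_nonneg (Real.rpow_nonneg n5 _) (Real.rpow_nonneg m5 _))
    (mul_nonneg (Real.rpow_nonneg n6 _) (Real.rpow_nonneg m6 _)) s₁ s₂ s₃ s₄ s₅ s₆

end Summit.CriticalPhenomena.PercolationContinuityZ3.Theorems.SunflowerPartition.SafeCalc.LinkedCurrency
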